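import Literature.Topology.FourManifolds.SimplifiedBrokenLefschetzSidesGenus
import Literature.Topology.FourManifolds.SurfaceGenusOneCircleProd
import Literature.Topology.FourManifolds.ImmersionCriterion
import Mathlib.Geometry.Manifold.LocalDiffeomorph
import HarnessLib

/-!
# Genus-one simplified broken Lefschetz fibrations: the torus side is `T² × ℝ²`

Topic `Literature/Topology/FourManifolds`; written for the fact seat
`provefact-Literature.Topology.FourManifolds.nonempty_diffeomorph_sphere_four_of_sblf_genus_one_noLefschetz`.
R. İ. Baykur, S. Kamada, *Classification of broken Lefschetz fibrations with small fiber genera*,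
J. Math. Soc. Japan 67 (2015), §5 ¶1 (*"One round singular circle, no Lefschetz singularity …
`X_h ≅ T² × D²`, `X_l ≅ S² × D²`"*), with Lemma 11 (the genus of the regular fibres) — the
first, fibre-identification step of the decomposition of a genus-one SBLF without Lefschetz
points, in OPEN form over the two open hemispheres complementary to the (equatorial) round
image.  Everything here is **proved**; no definition and no named fact is introduced.

The sphere side `X_l° ≅ 𝕊² × ℝ²` is `exists_pole_isSmoothEmbedding_sphere_two_prod_side`
(`SimplifiedBrokenLefschetzSidesGenus.lean`).  This file adds the torus side, now that the
classification of closed orientable surfaces in genus one is in the tree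
(`SurfaceGenusOneCircleProd.lean`: a closed connected orientable surface with `H₁ ≅ ℤ²` is
diffeomorphic to `Circle × Circle`):

* `exists_isSmoothEmbedding_circle_prod_circle_fibre_of_linearEquiv_fin_two` — **a genus-one
  regular fibre of an SBLF on a closed oriented `4`-manifold is a smoothly embedded torus**
  `Circle × Circle ↪ X` (the abstract fibre surface of
  `exists_orientable_surface_range_eq_preimage_injective_mfderiv`, oriented by the orientation of
  `X`, identified with `Circle × Circle` by the classification, and the immersion criterion
  `isSmoothEmbedding_of_injective_of_injective_mfderiv` for the composite across the change of
  model `𝓡 2 ⇝ (𝓡 1).prod (𝓡 1)`);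
* `exists_pole_isSmoothEmbedding_torus_prod_side` — **the torus side is `T² × ℝ²`, smoothly and
  fibrewise**: for a genus-one Lefschetz-free SBLF with equatorial round image there are a pole
  `v = ±e₂` and a smooth embedding `ι : (Circle × Circle) × ℝ² ↪ X` onto the side
  `f⁻¹{y | ⟪y, -v⟫ < 0}` with `ι (·, 0)` a smooth embedding onto the central fibre `f⁻¹(v)` and
  `f (ι (θ, w)) = σ₋ᵥ⁻¹ (univBall 0 2 w)`, while the opposite side `f⁻¹{y | ⟪y, v⟫ < 0}` is the
  sphere side (Ehresmann over the hemisphere,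
  `exists_isSmoothEmbedding_prod_range_eq_preimage_hemisphere`).

## References

* R. İ. Baykur, S. Kamada, J. Math. Soc. Japan 67 (2015), §2, §5 ¶1, Lemma 11. [BaykurKamada2015]
* M. W. Hirsch, *Differential Topology* (1976), Ch. 1 §3 Thm. 3.1, Ch. 9 §3 Thm. 3.5. [HirschDT1976]
* T. Bröcker, K. Jänich, *Introduction to Differential Topology* (1982), (8.12). [BrockerJanichIDT1982]
-/

noncomputable section

open scoped Manifold ContDiff Topology InnerProductSpace EuclideanSpace
open Set Function Metric OpenPartialHomeomorph
open Literature.AlgebraicTopology.SingularHomology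

namespace Literature.Topology.FourManifolds

namespace IsSimplifiedBrokenLefschetzFibration

variable {X : Type} [TopologicalSpace X] [T2Space X] [SecondCountableTopology X] [CompactSpace X]
  [ChartedSpace (EuclideanSpace ℝ (Fin 4)) X] [IsManifold (𝓡 4) ∞ X]
  {o : SmoothOrientation (𝓡 4) X} {f : X → Metric.sphere (0 : EuclideanSpace ℝ (Fin 3)) 1}
  {L : Finset X} {h : ℕ}

/-- **A genus-one regular fibre of an SBLF on a closed oriented 4-manifold is a smoothly embedded
torus `S¹ × S¹`.**  The fibre over a regular value `y` is the image of an embedding `e : F ↪ X`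
of a closed connected surface `F` with injective differential, orientable since `X` is
(`exists_orientable_surface_range_eq_preimage_injective_mfderiv`); `H₁(F) ≅ ℤ²` makes `F`
diffeomorphic to `Circle × Circle` (classification in genus one,
`nonempty_diffeomorph_circle_prod_circle_of_isOrientable_of_linearEquiv_fin_two`), and the
composite `Circle × Circle ≅ F ↪ X` is a smooth embedding by the immersion criterion (Hirsch
Ch. 1 §3 Thm. 3.1, `isSmoothEmbedding_of_injective_of_injective_mfderiv`).
[cite: BaykurKamada2015, §5 ¶1 and Lemma 11] [cite: HirschDT1976, Ch. 9 §3 Thm. 3.5] -/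
theorem exists_isSmoothEmbedding_circle_prod_circle_fibre_of_linearEquiv_fin_two
    (hf : IsSimplifiedBrokenLefschetzFibration o f L h)
    {y : Metric.sphere (0 : EuclideanSpace ℝ (Fin 3)) 1}
    (hy : ∀ q, f q = y → Surjective (mfderiv (𝓡 4) (𝓡 2) f q))
    (h1 : Nonempty ((Fin (2 * 1) → ℤ) ≃ₗ[ℤ] singularHomology ℤ ℤ ↥(f ⁻¹' {y}) 1)) :
    ∃ s : Circle × Circle → X,
      Manifold.IsSmoothEmbedding ((𝓡 1).prod (𝓡 1)) (𝓡 4) ∞ s ∧ range s = f ⁻¹' {y} := by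
  obtain ⟨F, _, _, _, _, _, e, hes, heemb, hrange, hor, hde⟩ :=
    exists_orientable_surface_range_eq_preimage_injective_mfderiv hf.contMDiff hy
  have hF : IsOrientable (𝓡 2) F := hor ⟨o⟩
  have hcpt : IsCompact (range e) :=
    hrange ▸ (isClosed_singleton.preimage hf.contMDiff.continuous).isCompact
  haveI : CompactSpace F := by
    rw [← isCompact_univ_iff, heemb.isInducing.isCompact_iff, image_univ]
    exact hcpt
  have hconn : IsConnected (range e) := hrange ▸ (hf.fibre y hy).1
  haveI : ConnectedSpace F := by
    rw [connectedSpace_iff_univ]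
    refine ⟨?_, ?_⟩
    · obtain ⟨_, ⟨z, rfl⟩⟩ := hconn.nonempty
      exact ⟨z, mem_univ z⟩
    · rw [← heemb.isInducing.isPreconnected_image, image_univ]
      exact hconn.isPreconnected
  let φ : F ≃ₜ ↥(f ⁻¹' {y}) := heemb.toHomeomorph.trans (Homeomorph.setCongr hrange)
  obtain ⟨l⟩ := h1
  have h1' : Nonempty ((Fin (2 * 1) → ℤ) ≃ₗ[ℤ] singularHomology ℤ ℤ F 1) :=
    ⟨l.trans (singularHomology.mapIso ℤ ℤ φ 1).toLinearEquiv.symm⟩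
  obtain ⟨Φ⟩ :=
    nonempty_diffeomorph_circle_prod_circle_of_isOrientable_of_linearEquiv_fin_two F hF h1'
  have h1le : (1 : ℕ∞ω) ≤ ∞ := by exact_mod_cast le_top
  have h0 : (∞ : ℕ∞ω) ≠ 0 := by simp
  refine ⟨e ∘ Φ.symm, ?_, ?_⟩
  · refine isSmoothEmbedding_of_injective_of_injective_mfderiv (hes.comp Φ.symm.contMDiff) h1le
      (heemb.injective.comp Φ.symm.injective) fun x => ?_
    rw [mfderiv_comp x ((hes _).mdifferentiableAt h0) (Φ.symm.mdifferentiable h0 x)]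
    have hΦ : Injective (mfderiv ((𝓡 1).prod (𝓡 1)) (𝓡 2) Φ.symm x) := by
      rw [← Diffeomorph.mfderivToContinuousLinearEquiv_coe Φ.symm h0]
      exact (Φ.symm.mfderivToContinuousLinearEquiv h0 x).injective
    exact (hde _).comp hΦ
  · have hr : range (Φ.symm : Circle × Circle → F) = univ :=
      eq_univ_of_forall fun z => ⟨Φ z, Φ.symm_apply_apply z⟩
    rw [range_comp, hr, image_univ, hrange]

omit h in
/-- **Genus one: the torus side is `T² × ℝ²`, smoothly and fibrewise** (Baykur–Kamada 2015,
§5 ¶1: *"`X_h ≅ T² × D²`"*, open form; companion of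
`exists_pole_isSmoothEmbedding_sphere_two_prod_side`).  For a genus-one Lefschetz-free SBLF
(`IsSimplifiedBrokenLefschetzFibration o f ∅ 0`, `X : Type`) with equatorial round image there
are a pole `v = ±e₂` and a smooth embedding `ι : (Circle × Circle) × ℝ² ↪ X` onto the side
`f⁻¹{y | ⟪y, -v⟫ < 0}` with `ι (·, 0)` a smoothly embedded torus onto the central fibre
`f⁻¹(v)` and `f (ι (θ, w)) = σ₋ᵥ⁻¹ (univBall 0 2 w)` (`σ₋ᵥ = stereographic' 2 (-v)`); the
opposite side `f⁻¹{y | ⟪y, v⟫ < 0}` is the sphere side (every fibre there is an embedded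
`2`-sphere).  Assembled from `exists_pole_lower_higher_sides`, the smoothly embedded torus fibre
`exists_isSmoothEmbedding_circle_prod_circle_fibre_of_linearEquiv_fin_two` and the product
structure over a hemisphere of regular values
`exists_isSmoothEmbedding_prod_range_eq_preimage_hemisphere` (`SimplifiedBrokenLefschetzSides.lean`).
[cite: BaykurKamada2015, §5 ¶1 and Lemma 11] [cite: BrockerJanichIDT1982, (8.12)] -/
theorem exists_pole_isSmoothEmbedding_torus_prod_side
    (hf : IsSimplifiedBrokenLefschetzFibration o f ∅ 0)
    (hround : f '' ({p : X | ¬ Surjective (mfderiv (𝓡 4) (𝓡 2) f p)} \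
      (↑(∅ : Finset X) : Set X)) = sphereEquator 1) :
    ∃ (v : (Metric.sphere (0 : EuclideanSpace ℝ (Fin 3)) 1))
      (ι : (Circle × Circle) × EuclideanSpace ℝ (Fin 2) → X),
          (v : EuclideanSpace ℝ (Fin 3)) 0 = 0 ∧ (v : EuclideanSpace ℝ (Fin 3)) 1 = 0 ∧
      Manifold.IsSmoothEmbedding (((𝓡 1).prod (𝓡 1)).prod 𝓘(ℝ, EuclideanSpace ℝ (Fin 2))) (𝓡 4)
        ∞ ι ∧
      range ι = f ⁻¹' {y | ⟪(y : EuclideanSpace ℝ (Fin 3)),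
        ((-v : (Metric.sphere (0 : EuclideanSpace ℝ (Fin 3)) 1)) : EuclideanSpace ℝ (Fin 3))⟫_ℝ
          < 0} ∧
      Manifold.IsSmoothEmbedding ((𝓡 1).prod (𝓡 1)) (𝓡 4) ∞ (fun θ ↦ ι (θ, 0)) ∧
      range (fun θ ↦ ι (θ, 0)) = f ⁻¹' {v} ∧
      (∀ p, f (ι p) = (stereographic' 2 (-v)).symm
        (univBall (0 : EuclideanSpace ℝ (Fin 2)) 2 p.2)) ∧
      ∀ y : (Metric.sphere (0 : EuclideanSpace ℝ (Fin 3)) 1), ⟪(y : EuclideanSpace ℝ (Fin 3)),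
            (v : EuclideanSpace ℝ (Fin 3))⟫_ℝ < 0 →
        (∀ q, f q = y → Surjective (mfderiv (𝓡 4) (𝓡 2) f q)) ∧
        ∃ s : (Metric.sphere (0 : EuclideanSpace ℝ (Fin 3)) 1) → X,
              ContMDiff (𝓡 2) (𝓡 4) ∞ s ∧ Topology.IsEmbedding s ∧ range s = f ⁻¹' {y} := by
  obtain ⟨v, hv0, hv1, hlo, hhi⟩ := hf.exists_pole_lower_higher_sides hround
  -- the central fibre `f⁻¹(v)` of the torus side
  have hvv : ⟪(v : EuclideanSpace ℝ (Fin 3)),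
      ((-v : (Metric.sphere (0 : EuclideanSpace ℝ (Fin 3)) 1)) : EuclideanSpace ℝ (Fin 3))⟫_ℝ
        < 0 := by
    rw [real_inner_comm]
    exact inner_neg_self_lt_zero v
  obtain ⟨hregv, hNv⟩ := hhi v hvv
  obtain ⟨s, hs, hsr⟩ :=
    hf.exists_isSmoothEmbedding_circle_prod_circle_fibre_of_linearEquiv_fin_two hregv hNv
  have hreg : ∀ q, ⟪(f q : EuclideanSpace ℝ (Fin 3)),
        ((-v : (Metric.sphere (0 : EuclideanSpace ℝ (Fin 3)) 1)) : EuclideanSpace ℝ (Fin 3))⟫_ℝ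
          < 0 → Surjective (mfderiv (𝓡 4) (𝓡 2) f q) :=
    fun q hq ↦ (hhi (f q) hq).1 q rfl
  have hdim : Module.finrank ℝ ((EuclideanSpace ℝ (Fin 1) × EuclideanSpace ℝ (Fin 1)) ×
        EuclideanSpace ℝ (Fin 2)) = Module.finrank ℝ (EuclideanSpace ℝ (Fin 4)) := by
    simp only [Module.finrank_prod, finrank_euclideanSpace_fin]
  let Λ : ((EuclideanSpace ℝ (Fin 1) × EuclideanSpace ℝ (Fin 1)) × EuclideanSpace ℝ (Fin 2)) ≃L[ℝ]
      EuclideanSpace ℝ (Fin 4) := ContinuousLinearEquiv.ofFinrankEq hdim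
  have hsr' : range s = f ⁻¹' {-(-v)} := by rw [neg_neg]; exact hsr
  obtain ⟨ι, hemb, hrange, hι0, hιf⟩ :=
    Literature.Topology.FourManifolds.exists_isSmoothEmbedding_prod_range_eq_preimage_hemisphere
      (I := 𝓡 4) (IF := (𝓡 1).prod (𝓡 1)) hf.contMDiff (-v) hreg hs Λ hsr'
  have hισ : (fun θ ↦ ι (θ, 0)) = s := funext hι0
  refine ⟨v, ι, hv0, hv1, hemb, hrange, ?_, ?_, hιf, fun y hy ↦ ?_⟩
  · rw [hισ]; exact hs
  · rw [hισ]; exact hsr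
  · obtain ⟨hregy, hN⟩ := hlo y hy
    exact ⟨hregy, hf.exists_sphere_two_fibre_of_linearEquiv_fin_zero hregy hN⟩

end IsSimplifiedBrokenLefschetzFibration

end Literature.Topology.FourManifolds

end
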